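import Literature.Barriers.CriticalPhenomena.LaceExpansionHaraLemma17G
import HarnessLib

/-!
# `∂_j^m Ĝ` as an integrable function on `[-π,π]^d` and Hara's identity (4.8)

Barrier catalogue `Literature/Barriers/CriticalPhenomena/` (D-0021), sequel of
`LaceExpansionHaraLemma41.lean` (Lemma 4.1: `|∂_j^m Ĝ(k)| ≤ C/|k|^{2+m}`) and
`LaceExpansionHaraLemma17G.lean` (the `Ḡ`-clause of Lemma 1.7 for integer exponents), on the way to the
product clauses `W̄, T̄, S̄` of the analytic named fact `Hara2008_lemma17Pc` (Hara 2008, Lemma 1.7,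
behind `Hara2008_xSpacePiBoundPc`). Those clauses rest on the `k`-space representations
`W_{jl}^{(β,γ)}(a) = ∫ e^{ika} Ĝ_j^{(β)}(k) Ĝ_l^{(γ)}(k)` ((4.10)–(4.13)), which need `∂_j^m Ĝ` as a
genuine integrable function on the cube whose Fourier coefficients are `(∓ i x_j)^m G(x)` ((4.8)).
PROVED here, for `Ĝ = ĝ/(1 - Ĵ)` under the hypotheses of Lemma 4.1:

* `sliceDeriv_kspaceTwoPoint_mul_one_sub` — the pointwise Leibniz identity
  `∂_j^m Ĝ · (1 - Ĵ) = ∂_j^m ĝ + Σ_{i<m} (m choose i) ∂_j^i Ĝ · ∂_j^{m-i} Ĵ` wherever `1 - Ĵ ≠ 0`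
  (Hara's "by explicit differentiation", (4.21));
* `continuousOn_sliceDeriv_kspaceTwoPoint` — `∂_j^m Ĝ` is continuous on `{1 - Ĵ ≠ 0}` (induction on
  the identity), hence a.e.-strongly measurable on the cube, and, by Lemma 4.1 and
  `∫ |k|^{-2-m} < ∞`, **integrable on `[-π,π]^d` for `m + 2 < d`**
  (`integrableOn_sliceDeriv_kspaceTwoPoint`);
* `integral_cexp_kdot_mul_sliceDeriv_eq` — **(4.8) on the whole cube**:
  `∫ e^{ik·y} ∂_j^m Ĝ(k) dk = (-iy_j)^m ∫ e^{ik·y} Ĝ(k) dk` (`y ∈ ℤ^d`), from the slice-wise identity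
  of `LaceExpansionCubeSliceIntegrals.lean` and Fubini on both sides;
* at `p = p_c` (`IsLaceCoefficientPc d Φ`, `Σ_x (1+|x|)^M|Π(x)| < ∞`):
  `∫ e^{ik·y} ∂_j^m Ĝ(k) dk = (-iy_j)^m (2π)^d τ_{p_c}(0,y)` and, for even `m = 2b`, Hara's
  `|x_j|^{2b} G(x) (2π)^d = (-1)^b ∫ e^{ikx} ∂_j^{2b} Ĝ(k) dk` (`IsLaceCoefficientPc.pow_mul_tau_eq_integral`).

## References

* T. Hara, Ann. Probab. 36 (2008) 530–593 (arXiv:math-ph/0504021; equation numbers are those of the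
  Ann. Probab. version): §4.1.1–§4.1.2 ((4.8)–(4.13)), Lemma 4.1 and §4.2 ((4.21)).
-/

noncomputable section

namespace Literature.Barriers.CriticalPhenomena

open _root_.MeasureTheory Filter Finset Literature.Probability.LatticeModels
  Literature.Probability.Percolation
open scoped Topology BigOperators ENNReal

variable {d : ℕ}

/-! ### The Leibniz identity for `∂_j^m Ĝ` and continuity away from the zeros of `1 - Ĵ` -/

section Leibniz

variable {J g : Site d → ℝ} {M : ℕ}

/-- **The Leibniz identity, pointwise**: where `1 - Ĵ(k) ≠ 0`,
`∂_j^m Ĝ(k) (1 - Ĵ(k)) = ∂_j^m ĝ(k) + Σ_{i<m} (m choose i) ∂_j^i Ĝ(k) ∂_j^{m-i} Ĵ(k)` (`m ≤ M`; the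
`m`-fold derivative of `Ĝ · (1 - Ĵ) = ĝ` along the coordinate `j`, the top term isolated).
[cite: Hara2008, proof of Lemma 4.1 ((4.21), "by explicit differentiation")] -/
theorem sliceDeriv_kspaceTwoPoint_mul_one_sub
    (hJ : Summable fun x => (1 + euclidNorm x) ^ M * |J x|)
    (hg : Summable fun x => (1 + euclidNorm x) ^ M * |g x|) (j : Fin d) {m : ℕ} (hm : m ≤ M)
    {k : Fin d → ℝ} (hk : (1 : ℂ) - latticeFT J k ≠ 0) :
    sliceDeriv (kspaceTwoPoint J g) j m k * (1 - latticeFT J k) =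
      latticeFTDn g j m k + ∑ i ∈ Finset.range m,
        (m.choose i : ℂ) * sliceDeriv (kspaceTwoPoint J g) j i k * latticeFTDn J j (m - i) k := by
  set u : ℝ → ℂ := fun s => latticeFT g (Function.update k j s) with hu_def
  set v : ℝ → ℂ := fun s => 1 - latticeFT J (Function.update k j s) with hv_def
  set w : ℝ → ℂ := fun s => u s / v s with hw_def
  have hu : ContDiffAt ℝ M u (k j) := contDiffAt_latticeFT_update hg k j (k j)
  have hv : ContDiffAt ℝ M v (k j) :=
    (contDiff_const.sub (contDiff_latticeFT_update hJ k j)).contDiffAt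
  have hvt : v (k j) ≠ 0 := by
    simp only [hv_def, Function.update_eq_self]
    exact hk
  have hw : ContDiffAt ℝ M w (k j) := by
    have h1 : ContDiffAt ℝ M (fun s => u s * (v s)⁻¹) (k j) := hu.mul (hv.inv hvt)
    have h2 : w = fun s => u s * (v s)⁻¹ := funext fun s => div_eq_mul_inv _ _
    rw [h2]
    exact h1
  have hmM' : (m : WithTop ℕ∞) ≤ (M : WithTop ℕ∞) := by exact_mod_cast hm
  have hL := iteratedDeriv_fun_mul (hw.of_le hmM') (hv.of_le hmM')
  have hev : (fun s => w s * v s) =ᶠ[𝓝 (k j)] u := by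
    filter_upwards [hv.continuousAt.eventually_ne hvt] with s hs
    simp only [hw_def]
    exact div_mul_cancel₀ (u s) hs
  rw [hev.iteratedDeriv_eq m, Finset.sum_range_succ, Nat.choose_self, Nat.sub_self, iteratedDeriv_zero,
    Nat.cast_one, one_mul] at hL
  -- identify the pieces
  have hsd : ∀ i, sliceDeriv (kspaceTwoPoint J g) j i k = iteratedDeriv i w (k j) := fun i => rfl
  have hum : iteratedDeriv m u (k j) = latticeFTDn g j m k := iteratedDeriv_latticeFT_update_apply hg k j hm
  have hv0 : v (k j) = 1 - latticeFT J k := by simp only [hv_def, Function.update_eq_self]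
  have hvi : ∀ i ∈ Finset.range m, iteratedDeriv (m - i) v (k j) = -latticeFTDn J j (m - i) k := by
    intro i hi
    have him : i < m := Finset.mem_range.1 hi
    exact iteratedDeriv_one_sub_latticeFT_update hJ k j (by omega) (by omega)
  have hsum : ∑ x ∈ Finset.range m, (m.choose x : ℂ) * iteratedDeriv x w (k j) * iteratedDeriv (m - x) v (k j) =
      -∑ i ∈ Finset.range m,
        (m.choose i : ℂ) * sliceDeriv (kspaceTwoPoint J g) j i k * latticeFTDn J j (m - i) k := by
    rw [← Finset.sum_neg_distrib]
    refine Finset.sum_congr rfl fun i hi => ?_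
    rw [hvi i hi, ← hsd i]
    ring
  rw [hsd m, ← hv0, ← hum, hL, hsum]
  ring

/-- **`∂_j^m Ĝ` is continuous away from the zeros of `1 - Ĵ`** (`m ≤ M`): by induction on the
Leibniz identity, `∂_j^m Ĝ = (∂_j^m ĝ + Σ_{i<m} (m choose i) ∂_j^i Ĝ ∂_j^{m-i}Ĵ)/(1 - Ĵ)` there.
[cite: Hara2008, proof of Lemma 4.1 ((4.21))] -/
theorem continuousOn_sliceDeriv_kspaceTwoPoint
    (hJ : Summable fun x => (1 + euclidNorm x) ^ M * |J x|)
    (hg : Summable fun x => (1 + euclidNorm x) ^ M * |g x|) (j : Fin d) {m : ℕ} (hm : m ≤ M) :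
    ContinuousOn (sliceDeriv (kspaceTwoPoint J g) j m) {k | (1 : ℂ) - latticeFT J k ≠ 0} := by
  induction m using Nat.strong_induction_on with
  | _ m ih =>
  set U : Set (Fin d → ℝ) := {k | (1 : ℂ) - latticeFT J k ≠ 0} with hU
  have hJ0 : Summable fun x => |J x| := summable_abs_of_moment hJ
  have hvc : Continuous fun k : Fin d → ℝ => (1 : ℂ) - latticeFT J k :=
    continuous_const.sub (continuous_latticeFT hJ0)
  -- the right-hand side of the identity
  set R : (Fin d → ℝ) → ℂ := fun k => (latticeFTDn g j m k + ∑ i ∈ Finset.range m,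
    (m.choose i : ℂ) * sliceDeriv (kspaceTwoPoint J g) j i k * latticeFTDn J j (m - i) k) /
      (1 - latticeFT J k) with hR
  have hRc : ContinuousOn R U := by
    refine ContinuousOn.div ?_ hvc.continuousOn (fun k hk => hk)
    refine (continuous_latticeFTDn hg j hm).continuousOn.add ?_
    refine continuousOn_finsetSum _ fun i hi => ?_
    have him : i < m := Finset.mem_range.1 hi
    exact ((continuousOn_const.mul (ih i him (by omega))).mul
      (continuous_latticeFTDn hJ j (by omega : m - i ≤ M)).continuousOn)
  refine hRc.congr fun k hk => ?_
  have h := sliceDeriv_kspaceTwoPoint_mul_one_sub hJ hg j hm hk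
  simp only [hR]
  rw [← h, mul_div_assoc, div_self hk, mul_one]

end Leibniz

/-! ### Integrability of `∂_j^m Ĝ` on the cube -/

/-- The origin is a Lebesgue-null set of `ℝ^d`, `d ≥ 1` (in the form used to pass between the cube
and the punctured cube). [folklore] -/
theorem volume_singleton_zero (hd : 1 ≤ d) : (volume : Measure (Fin d → ℝ)) {0} = 0 := by
  have h := P_singleton_zero hd
  rw [← Slade2006Prop53.volume_restrict_cube d,
    Measure.restrict_apply (measurableSet_singleton 0)] at h
  have h' : (volume : Measure (Fin d → ℝ)) (({0} : Set (Fin d → ℝ)) ∩ cube d) = 0 := h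
  have h0 : ({0} : Set (Fin d → ℝ)) ∩ cube d = {0} := by
    refine Set.inter_eq_left.2 (Set.singleton_subset_iff.2 fun i _ => ?_)
    simp only [Pi.zero_apply, Set.mem_Icc]
    constructor <;> linarith [Real.pi_pos]
  rwa [h0] at h'

/-- Restricting Lebesgue measure to the punctured cube or to the cube is the same. [folklore] -/
theorem volume_restrict_cube_diff_zero (hd : 1 ≤ d) :
    (volume : Measure (Fin d → ℝ)).restrict (cube d \ {0}) = volume.restrict (cube d) :=
  Measure.restrict_congr_set (sdiff_null_ae_eq_self (volume_singleton_zero hd))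

variable {J g : Site d → ℝ} {M : ℕ}

/-- **`∂_j^m Ĝ` is a.e.-strongly measurable on the cube** (continuous on the punctured cube, which
the lower bound `c₀|k|² ≤ |1 - Ĵ|` places inside `{1 - Ĵ ≠ 0}`). [folklore] -/
theorem aestronglyMeasurable_sliceDeriv_kspaceTwoPoint (hd : 1 ≤ d)
    (hJ : Summable fun x => (1 + euclidNorm x) ^ M * |J x|)
    (hg : Summable fun x => (1 + euclidNorm x) ^ M * |g x|)
    {c₀ : ℝ} (hc₀ : 0 < c₀) (hlow : ∀ k ∈ cube d, c₀ * knorm k ^ 2 ≤ ‖1 - latticeFT J k‖)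
    (j : Fin d) {m : ℕ} (hm : m ≤ M) :
    AEStronglyMeasurable (sliceDeriv (kspaceTwoPoint J g) j m) (volume.restrict (cube d)) := by
  have hsub : cube d \ {0} ⊆ {k | (1 : ℂ) - latticeFT J k ≠ 0} := by
    rintro k ⟨hk, hk0⟩
    have hk0' : k ≠ 0 := fun h => hk0 (Set.mem_singleton_iff.2 h)
    have hpos : 0 < c₀ * knorm k ^ 2 := mul_pos hc₀ (pow_pos (knorm_pos_of_ne_zero hk0') 2)
    intro h
    have := hlow k hk
    rw [h, norm_zero] at this
    linarith
  have hc := (continuousOn_sliceDeriv_kspaceTwoPoint hJ hg j hm).mono hsub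
  rw [← volume_restrict_cube_diff_zero hd]
  exact hc.aestronglyMeasurable ((measurableSet_cube d).diff (measurableSet_singleton 0))

/-- **`∂_j^m Ĝ ∈ L¹([-π,π]^d)` for `m + 2 < d`** (`m ≤ M`, `M ≥ 2`): Lemma 4.1 gives
`|∂_j^m Ĝ(k)| ≤ C/|k|^{2+m}` off the origin and `∫ |k|^{-2-m} < ∞` — Hara's "finite for `2 + α < d`".
[cite: Hara2008, §4.1.2 ((4.9)) and Lemma 4.1] -/
theorem integrableOn_sliceDeriv_kspaceTwoPoint (hM2 : 2 ≤ M)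
    (hJ : Summable fun x => (1 + euclidNorm x) ^ M * |J x|)
    (hg : Summable fun x => (1 + euclidNorm x) ^ M * |g x|) (hJs : IsZdSymmetric J)
    {c₀ : ℝ} (hc₀ : 0 < c₀) (hlow : ∀ k ∈ cube d, c₀ * knorm k ^ 2 ≤ ‖1 - latticeFT J k‖)
    (j : Fin d) {m : ℕ} (hm : m ≤ M) (hmd : m + 2 < d) :
    IntegrableOn (sliceDeriv (kspaceTwoPoint J g) j m) (cube d) := by
  have hd : 1 ≤ d := by omega
  obtain ⟨C, hC⟩ := norm_sliceDeriv_kspaceTwoPoint_le hM2 hJ hg hJs hc₀ hlow j hm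
  have hΨ : IntegrableOn (fun k : Fin d → ℝ => C * (1 / knorm k ^ (2 + m))) (cube d) :=
    (integrableOn_one_div_knorm_pow hd (by omega)).const_mul C
  refine Integrable.mono' hΨ (aestronglyMeasurable_sliceDeriv_kspaceTwoPoint hd hJ hg hc₀ hlow j hm) ?_
  filter_upwards [ae_restrict_mem (measurableSet_cube d), ae_restrict_cube_ne_zero hd] with k hk hk0
  rw [mul_one_div]
  exact hC k hk hk0

/-- In particular (`m = 0`) `Ĝ` itself is integrable on the cube for `d ≥ 3` — the infrared bound
`|Ĝ| ≤ C/|k|²`. [cite: Hara2008, Prop. 1.2 ((1.18), infrared bound) and Appendix A (item 4)] -/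
theorem integrableOn_kspaceTwoPoint (hM2 : 2 ≤ M)
    (hJ : Summable fun x => (1 + euclidNorm x) ^ M * |J x|)
    (hg : Summable fun x => (1 + euclidNorm x) ^ M * |g x|) (hJs : IsZdSymmetric J)
    {c₀ : ℝ} (hc₀ : 0 < c₀) (hlow : ∀ k ∈ cube d, c₀ * knorm k ^ 2 ≤ ‖1 - latticeFT J k‖)
    (hd : 3 ≤ d) : IntegrableOn (kspaceTwoPoint J g) (cube d) := by
  obtain ⟨j⟩ : Nonempty (Fin d) := ⟨⟨0, by omega⟩⟩
  have h := integrableOn_sliceDeriv_kspaceTwoPoint hM2 hJ hg hJs hc₀ hlow j (Nat.zero_le M) (by omega)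
  refine h.congr_fun (fun k _ => ?_) (measurableSet_cube d)
  simp

/-! ### Hara's (4.8) on the whole cube -/

section Identity

variable {n : ℕ}

/-- Splitting a character along a slice: for any `H`,
`∫_{[-π,π]} e^{i ins_l(s,k')·y} H(ins_l(s,k')) ds = e^{ik'·y'} ∫_{[-π,π]} e^{isy_l} H(ins_l(s,k')) ds`
(`y'` the transverse coordinates of `y`). [folklore] -/
theorem setIntegral_cexp_kdot_insertNth_mul (l : Fin (n + 1)) (k' : Fin n → ℝ) (y : Site (n + 1))
    (H : (Fin (n + 1) → ℝ) → ℂ) :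
    ∫ s in Set.Icc (-Real.pi) Real.pi,
        Complex.exp (Complex.I * (kdot (l.insertNth s k' : Fin (n + 1) → ℝ) y : ℂ)) * H (l.insertNth s k') =
      Complex.exp (Complex.I * (kdot k' (fun i => y (l.succAbove i)) : ℂ)) *
        ∫ s in Set.Icc (-Real.pi) Real.pi,
          Complex.exp (Complex.I * ((s : ℂ) * (y l : ℂ))) * H (l.insertNth s k') := by
  rw [← integral_const_mul]
  refine setIntegral_congr_fun measurableSet_Icc fun s _ => ?_
  rw [kdot_insertNth]
  push_cast
  rw [show Complex.I * ((s : ℂ) * ((y l : ℤ) : ℂ) + (kdot k' (fun i => y (l.succAbove i)) : ℂ)) =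
      Complex.I * (kdot k' (fun i => y (l.succAbove i)) : ℂ) + Complex.I * ((s : ℂ) * ((y l : ℤ) : ℂ))
      by ring, Complex.exp_add]
  ring

variable {J g : Site (n + 1) → ℝ} {M : ℕ}

/-- **(4.8) on a slice**: for `k' ∈ [-π,π]^n ∖ {0}`,
`∫ e^{i ins(s,k')·y} ∂_l^m Ĝ(ins(s,k')) ds = (-iy_l)^m ∫ e^{i ins(s,k')·y} Ĝ(ins(s,k')) ds`.
[cite: Hara2008, §4.1.2 ((4.8))] -/
theorem setIntegral_slice_sliceDeriv_eq
    (hJ : Summable fun x => (1 + euclidNorm x) ^ M * |J x|)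
    (hg : Summable fun x => (1 + euclidNorm x) ^ M * |g x|)
    {c₀ : ℝ} (hc₀ : 0 < c₀) (hlow : ∀ k ∈ cube (n + 1), c₀ * knorm k ^ 2 ≤ ‖1 - latticeFT J k‖)
    (l : Fin (n + 1)) {m : ℕ} (hm : m ≤ M) {k' : Fin n → ℝ} (hk' : k' ∈ cube n) (hk'0 : k' ≠ 0)
    (y : Site (n + 1)) :
    ∫ s in Set.Icc (-Real.pi) Real.pi,
        Complex.exp (Complex.I * (kdot (l.insertNth s k' : Fin (n + 1) → ℝ) y : ℂ)) *
          sliceDeriv (kspaceTwoPoint J g) l m (l.insertNth s k') =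
      (-(Complex.I * (y l : ℂ))) ^ m * ∫ s in Set.Icc (-Real.pi) Real.pi,
        Complex.exp (Complex.I * (kdot (l.insertNth s k' : Fin (n + 1) → ℝ) y : ℂ)) *
          kspaceTwoPoint J g (l.insertNth s k') := by
  obtain ⟨hF, hper⟩ := contDiff_kspaceTwoPoint_insertNth hJ hg hc₀ hlow l hk' hk'0
  have hπ : -Real.pi ≤ Real.pi := by linarith [Real.pi_pos]
  have hibp := intervalIntegral_cexp_mul_iteratedDeriv_eq (hF.of_le (by exact_mod_cast hm)) hper (y l)
  rw [setIntegral_cexp_kdot_insertNth_mul, setIntegral_cexp_kdot_insertNth_mul]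
  simp_rw [sliceDeriv_insertNth]
  rw [integral_Icc_eq_integral_Ioc, ← intervalIntegral.integral_of_le hπ, hibp,
    intervalIntegral.integral_of_le hπ, ← integral_Icc_eq_integral_Ioc]
  ring

/-- **Hara's (4.8) on the whole cube**: for `m ≤ M`, `m + 2 < d` and `y ∈ ℤ^d`,
`∫_{[-π,π]^d} e^{ik·y} ∂_j^m Ĝ(k) dk = (-iy_j)^m ∫_{[-π,π]^d} e^{ik·y} Ĝ(k) dk` — both integrands are
integrable, Fubini along `j`, and the slice identity for almost every transverse momentum.
[cite: Hara2008, §4.1.2 ((4.8): Ĝ_j^{(2n)}(k) = (-1)^n ∂_j^{2n} Ĝ(k))] -/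
theorem integral_cexp_kdot_mul_sliceDeriv_eq (hM2 : 2 ≤ M)
    (hJ : Summable fun x => (1 + euclidNorm x) ^ M * |J x|)
    (hg : Summable fun x => (1 + euclidNorm x) ^ M * |g x|) (hJs : IsZdSymmetric J)
    {c₀ : ℝ} (hc₀ : 0 < c₀) (hlow : ∀ k ∈ cube (n + 1), c₀ * knorm k ^ 2 ≤ ‖1 - latticeFT J k‖)
    (j : Fin (n + 1)) {m : ℕ} (hm : m ≤ M) (hmd : m + 2 < n + 1) (y : Site (n + 1)) :
    ∫ k in cube (n + 1), Complex.exp (Complex.I * (kdot k y : ℂ)) * sliceDeriv (kspaceTwoPoint J g) j m k =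
      (-(Complex.I * (y j : ℂ))) ^ m *
        ∫ k in cube (n + 1), Complex.exp (Complex.I * (kdot k y : ℂ)) * kspaceTwoPoint J g k := by
  have hn1 : 1 ≤ n := by omega
  have hi1 : IntegrableOn (fun k => Complex.exp (Complex.I * (kdot k y : ℂ)) *
      sliceDeriv (kspaceTwoPoint J g) j m k) (cube (n + 1)) :=
    integrableOn_cexp_kdot_mul (integrableOn_sliceDeriv_kspaceTwoPoint hM2 hJ hg hJs hc₀ hlow j hm hmd) y
  have hi0 : IntegrableOn (fun k => Complex.exp (Complex.I * (kdot k y : ℂ)) * kspaceTwoPoint J g k)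
      (cube (n + 1)) :=
    integrableOn_cexp_kdot_mul (integrableOn_kspaceTwoPoint hM2 hJ hg hJs hc₀ hlow (by omega)) y
  rw [integral_cube_succ_eq_iterated_of_integrable j hi1, integral_cube_succ_eq_iterated_of_integrable j hi0,
    ← integral_const_mul]
  refine integral_congr_ae ?_
  filter_upwards [ae_restrict_mem (measurableSet_cube n), ae_restrict_cube_ne_zero hn1] with k' hk' hk'0
  exact setIntegral_slice_sliceDeriv_eq hJ hg hc₀ hlow j hm hk' hk'0 y

end Identity

/-! ### At `p = p_c`: `x_j^m τ_{p_c}(0,x)` as a Fourier coefficient -/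

/-- `e^{ik·y} Ĝ(k)` is the integrand of Hara's `H(y)`. [folklore] -/
theorem cexp_kdot_mul_kspaceTwoPoint (J g : Site d → ℝ) (y : Site d) (k : Fin d → ℝ) :
    Complex.exp (Complex.I * (kdot k y : ℂ)) * kspaceTwoPoint J g k = haraIntegrand J g y k := rfl

/-- **(4.8) at `p_c`**: for a lace-expansion coefficient `Φ` with `Σ_x (1+|x|)^M|Π(x)| < ∞`, `M ≥ 2`,
and `m ≤ M`, `m + 2 < d`:
`∫_{[-π,π]^d} e^{ik·y} ∂_j^m Ĝ(k) dk = (-iy_j)^m (2π)^d τ_{p_c}(0,y)`.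
[cite: Hara2008, §4.1.2 ((4.8)) and Prop. 1.2 ((1.11))] -/
theorem IsLaceCoefficientPc.integral_cexp_kdot_mul_sliceDeriv {Φ : Site d → ℝ}
    (h : IsLaceCoefficientPc d Φ) {M : ℕ} (hM2 : 2 ≤ M)
    (hmom : Summable fun x => (1 + euclidNorm x) ^ M * |Φ x|) (j : Fin d) {m : ℕ} (hm : m ≤ M)
    (hmd : m + 2 < d) (y : Site d) :
    ∫ k in cube d, Complex.exp (Complex.I * (kdot k y : ℂ)) *
        sliceDeriv (kspaceTwoPoint (laceKernel (criticalProbI d) Φ) (laceSource Φ)) j m k =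
      (-(Complex.I * (y j : ℂ))) ^ m * (((2 * Real.pi : ℂ)) ^ d * ((tau d (criticalProbI d) 0 y : ℝ) : ℂ)) := by
  obtain ⟨n, rfl⟩ : ∃ n, d = n + 1 := ⟨d - 1, by omega⟩
  obtain ⟨c₀, hc₀, hlow⟩ := h.exists_knorm_sq_le_norm
  rw [integral_cexp_kdot_mul_sliceDeriv_eq hM2 (summable_moment_laceKernel hmom _)
    (summable_moment_laceSource hmom) (isZdSymmetric_laceKernel h.symm _) hc₀ hlow j hm hmd y]
  congr 1
  simp_rw [cexp_kdot_mul_kspaceTwoPoint]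
  exact h.integral_eq y

/-- **Hara's `G_j^{(2b)}` as a Fourier coefficient at `p_c`**: for even `m = 2b` (`2b ≤ M`, `2b + 2 < d`),
`x_j^{2b} τ_{p_c}(0,x) · (2π)^d = (-1)^b ∫_{[-π,π]^d} e^{ik·x} ∂_j^{2b} Ĝ(k) dk` — "`Ĝ_j^{(2n)}(k) =
(-1)^n ∂_j^{2n} Ĝ(k)`". [cite: Hara2008, §4.1.2 ((4.8))] -/
theorem IsLaceCoefficientPc.pow_mul_tau_eq_integral {Φ : Site d → ℝ}
    (h : IsLaceCoefficientPc d Φ) {M : ℕ} (hM2 : 2 ≤ M)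
    (hmom : Summable fun x => (1 + euclidNorm x) ^ M * |Φ x|) (j : Fin d) {b : ℕ} (hb : 2 * b ≤ M)
    (hbd : 2 * b + 2 < d) (y : Site d) :
    ((y j : ℂ)) ^ (2 * b) * (((2 * Real.pi : ℂ)) ^ d * ((tau d (criticalProbI d) 0 y : ℝ) : ℂ)) =
      (-1 : ℂ) ^ b * ∫ k in cube d, Complex.exp (Complex.I * (kdot k y : ℂ)) *
        sliceDeriv (kspaceTwoPoint (laceKernel (criticalProbI d) Φ) (laceSource Φ)) j (2 * b) k := by
  have hI : (-(Complex.I * (y j : ℂ))) ^ (2 * b) = (-1 : ℂ) ^ b * ((y j : ℂ)) ^ (2 * b) := by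
    rw [pow_mul, pow_mul, show (-(Complex.I * (y j : ℂ))) ^ 2 = -1 * (y j : ℂ) ^ 2 by
      rw [neg_sq, mul_pow, Complex.I_sq], mul_pow]
  have h1 : ((-1 : ℂ)) ^ b * (-1) ^ b = 1 := by
    rw [← mul_pow, neg_one_mul, neg_neg, one_pow]
  rw [h.integral_cexp_kdot_mul_sliceDeriv hM2 hmom j hb hbd y, hI]
  linear_combination (-(((y j : ℂ)) ^ (2 * b) *
    (((2 * Real.pi : ℂ)) ^ d * ((tau d (criticalProbI d) 0 y : ℝ) : ℂ)))) * h1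

end Literature.Barriers.CriticalPhenomena
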